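import Literature.Computability.AlgebraicComplexity.LandsbergRessayrePairsMinor
import Literature.Computability.AlgebraicComplexity.LandsbergRessayrePairsRelabel
import Literature.Computability.AlgebraicComplexity.LandsbergRessayreThm21Proofs
import HarnessLib

/-!
# Landsberg–Ressayre's equivariant determinantal representation of the permanent, IV:
# `edc_{𝔾_{perm_m}}(per_m) ≤ C(2m,m) - 1` (LR 2017, Prop. 2.10) and `= C(2m,m) - 1` (Thm. 2.1)

Topic `Literature/Computability/AlgebraicComplexity`; last of the four files. Assembly:
* `LRPairs.leftMonomialSubst_le_closure`, `rightMonomialSubst_le_closure`,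
  `permSymmetrySubst_le_closure` — the realised symmetry group `permSymmetrySubst k m` of
  `LandsbergRessayre.lean` (left/right monomial substitutions and the transposition, LR's
  `𝔾_{perm_m} ≅ [(N(T^{GL(E)}) × N(T^{GL(F)}))/ℂ*] ⋊ ℤ₂`) is generated by `P_π ⊗ 1`, `diag d ⊗ 1`,
  `1 ⊗ P_π`, `1 ⊗ diag e` and the transposition;
* `LRPairs.isEquivariantDetRepr_minor` — the signed minor `M₀` (`det = m! · per_m`) respects
  `permSymmetrySubst` with exact lifts (`IsEquivariantDetRepr.of_generators` on files II–III);
* `hasEquivariantDetRepr_perPoly_permSymmetrySubst` — dividing one row of `M₀` by `m!` (a constant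
  gauge, `forall_exists_lift_mul_mul`) gives a `permSymmetrySubst`-EQUIVARIANT affine determinantal
  representation of `per_m` of size `C(2m,m) - 1` over any field with `m! ≠ 0`: **LR 2017 Prop. 2.10**
  in the tree's exact-lift sense ("The following is an equivariant determinantal representation of
  `perm_m`: Let `ℂ^n = ⊕_{k=0}^{m-1}(S^kE)_reg ⊗ (S^kF^*)_reg`, so `n = C(2m,m) - 1 ∼ 4^m` …");
* `equivariantDetComplexity_permSymmetrySubst_perPoly_le`, and with the tree's lower bound
  `le_equivariantDetComplexity_full` (`LandsbergRessayreThm21Proofs.lean`, LR Thm. 2.1 `≥`, PROVED)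
  **`equivariantDetComplexity_permSymmetrySubst_perPoly_eq`: `edc(perm_m) = C(2m,m) - 1` over `ℂ`
  for `m ≥ 3`** — Landsberg–Ressayre 2017, Thm. 2.1 in full, previously only its lower half in the
  tree (`lr_full_equivariant_lower_holds`).
Honest framing: a published theorem about EQUIVARIANT representations, formalised; it says nothing
about `dc(per_m)` without symmetry (route `DetQP`'s item `DetqpSymmetrization` asks whether
symmetrisation is cheap — open) and nothing about VP versus VNP.

## References

* J. M. Landsberg, N. Ressayre, *Permanent v. determinant: an exponential lower bound assuming
  symmetry and a potential path towards Valiant's conjecture*, Differential Geom. Appl. 55 (2017)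
  146–166, arXiv:1508.05788: §2.3, Prop. 2.10 (held text `paper:arxiv-1508.05788` p0006);
  Thm. 2.1 (`edc(perm_m) = C(2m,m) - 1`, `m ≥ 3`). [LandsbergRessayre2017]
* B. Grenet, *An upper bound for the permanent versus determinant problem* (2011), Thm. 1 — the
  one-sided model of the construction (tree: `PermanentVsDeterminantProofs.lean`,
  `GrenetEquivariant.lean`). [Grenet2011]
-/

noncomputable section

open MvPolynomial Matrix Finset
open scoped Kronecker

namespace Literature.Computability.AlgebraicComplexity

namespace LRPairs

/-! ### The symmetry group is generated by the five kinds of generators -/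

section Group

variable (k : Type*) [Field k] (m : ℕ)

/-- `leftMonomialSubst` lies in the subgroup generated by the substitutions `P_π ⊗ 1` and
`diag d ⊗ 1` (push the generators of `monomialSubgroup` through the hom `g ↦ g ⊗ 1`; also proved,
not importable here, in `Summits/…/ProjectionStabilityOptStepStubGrenetLeftEquivariant.lean`).
[cite: LandsbergRessayre2017, §2.1] -/
theorem leftMonomialSubst_le_closure :
    leftMonomialSubst k m ≤ Subgroup.closure
      ({γ : GL (Fin m × Fin m) k | ∃ π : Equiv.Perm (Fin m),
          (γ : Matrix (Fin m × Fin m) (Fin m × Fin m) k) = π.permMatrix k ⊗ₖ (1 : Matrix (Fin m) (Fin m) k)} ∪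
        {γ | ∃ d : Fin m → k,
          (γ : Matrix (Fin m × Fin m) (Fin m × Fin m) k) = Matrix.diagonal d ⊗ₖ (1 : Matrix (Fin m) (Fin m) k)}) := by
  let K : GL (Fin m) k →* GL (Fin m × Fin m) k :=
    { toFun := fun g => Matrix.GeneralLinearGroup.kronecker g 1
      map_one' := Units.ext (by
        show ((1 : GL (Fin m) k) : Matrix (Fin m) (Fin m) k) ⊗ₖ
            ((1 : GL (Fin m) k) : Matrix (Fin m) (Fin m) k) = 1
        rw [Units.val_one, Matrix.one_kronecker_one])
      map_mul' := fun x y => Units.ext (by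
        show ((x * y : GL (Fin m) k) : Matrix (Fin m) (Fin m) k) ⊗ₖ
            ((1 : GL (Fin m) k) : Matrix (Fin m) (Fin m) k) =
          ((x : Matrix (Fin m) (Fin m) k) ⊗ₖ ((1 : GL (Fin m) k) : Matrix (Fin m) (Fin m) k)) *
            ((y : Matrix (Fin m) (Fin m) k) ⊗ₖ ((1 : GL (Fin m) k) : Matrix (Fin m) (Fin m) k))
        rw [← Matrix.mul_kronecker_mul, Units.val_mul, Units.val_one, Matrix.mul_one]) }
  have hK : ∀ g : GL (Fin m) k,
      ((K g : GL (Fin m × Fin m) k) : Matrix (Fin m × Fin m) (Fin m × Fin m) k) =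
        (g : Matrix (Fin m) (Fin m) k) ⊗ₖ 1 := fun _ => rfl
  rw [leftMonomialSubst, Subgroup.closure_le]
  rintro γ ⟨g, hg, hγ⟩
  have hγK : γ = K g := Units.ext (by rw [hK, hγ])
  subst hγK
  rw [SetLike.mem_coe, ← Subgroup.mem_comap]
  unfold monomialSubgroup at hg
  refine (Subgroup.closure_le _).mpr ?_ hg
  rintro g' (⟨π, hπ⟩ | ⟨d, hd⟩)
  · rw [SetLike.mem_coe, Subgroup.mem_comap]
    exact Subgroup.subset_closure (Or.inl ⟨π, by rw [hK, hπ]⟩)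
  · rw [SetLike.mem_coe, Subgroup.mem_comap]
    exact Subgroup.subset_closure (Or.inr ⟨d, by rw [hK, hd]⟩)

/-- `rightMonomialSubst` lies in the subgroup generated by the substitutions `1 ⊗ P_π` and
`1 ⊗ diag e` (hom `h ↦ 1 ⊗ h`). [cite: LandsbergRessayre2017, §2.1] -/
theorem rightMonomialSubst_le_closure :
    rightMonomialSubst k m ≤ Subgroup.closure
      ({γ : GL (Fin m × Fin m) k | ∃ π : Equiv.Perm (Fin m),
          (γ : Matrix (Fin m × Fin m) (Fin m × Fin m) k) = (1 : Matrix (Fin m) (Fin m) k) ⊗ₖ π.permMatrix k} ∪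
        {γ | ∃ e : Fin m → k,
          (γ : Matrix (Fin m × Fin m) (Fin m × Fin m) k) = (1 : Matrix (Fin m) (Fin m) k) ⊗ₖ Matrix.diagonal e}) := by
  let K : GL (Fin m) k →* GL (Fin m × Fin m) k :=
    { toFun := fun g => Matrix.GeneralLinearGroup.kronecker 1 g
      map_one' := Units.ext (by
        show ((1 : GL (Fin m) k) : Matrix (Fin m) (Fin m) k) ⊗ₖ
            ((1 : GL (Fin m) k) : Matrix (Fin m) (Fin m) k) = 1
        rw [Units.val_one, Matrix.one_kronecker_one])
      map_mul' := fun x y => Units.ext (by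
        show ((1 : GL (Fin m) k) : Matrix (Fin m) (Fin m) k) ⊗ₖ
            ((x * y : GL (Fin m) k) : Matrix (Fin m) (Fin m) k) =
          (((1 : GL (Fin m) k) : Matrix (Fin m) (Fin m) k) ⊗ₖ (x : Matrix (Fin m) (Fin m) k)) *
            (((1 : GL (Fin m) k) : Matrix (Fin m) (Fin m) k) ⊗ₖ (y : Matrix (Fin m) (Fin m) k))
        rw [← Matrix.mul_kronecker_mul, Units.val_mul, Units.val_one, Matrix.mul_one]) }
  have hK : ∀ g : GL (Fin m) k,
      ((K g : GL (Fin m × Fin m) k) : Matrix (Fin m × Fin m) (Fin m × Fin m) k) =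
        1 ⊗ₖ (g : Matrix (Fin m) (Fin m) k) := fun _ => rfl
  rw [rightMonomialSubst, Subgroup.closure_le]
  rintro γ ⟨g, hg, hγ⟩
  have hγK : γ = K g := Units.ext (by rw [hK, hγ])
  subst hγK
  rw [SetLike.mem_coe, ← Subgroup.mem_comap]
  unfold monomialSubgroup at hg
  refine (Subgroup.closure_le _).mpr ?_ hg
  rintro g' (⟨π, hπ⟩ | ⟨d, hd⟩)
  · rw [SetLike.mem_coe, Subgroup.mem_comap]
    exact Subgroup.subset_closure (Or.inl ⟨π, by rw [hK, hπ]⟩)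
  · rw [SetLike.mem_coe, Subgroup.mem_comap]
    exact Subgroup.subset_closure (Or.inr ⟨d, by rw [hK, hd]⟩)

/-- **`permSymmetrySubst` is generated by the five kinds of substitutions** `P_π ⊗ 1`,
`diag d ⊗ 1`, `1 ⊗ P_π`, `1 ⊗ diag e` and the transposition. [cite: LandsbergRessayre2017, §2.1] -/
theorem permSymmetrySubst_le_closure :
    permSymmetrySubst k m ≤ Subgroup.closure
      ((({γ : GL (Fin m × Fin m) k | ∃ π : Equiv.Perm (Fin m),
          (γ : Matrix (Fin m × Fin m) (Fin m × Fin m) k) = π.permMatrix k ⊗ₖ (1 : Matrix (Fin m) (Fin m) k)} ∪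
        {γ | ∃ d : Fin m → k,
          (γ : Matrix (Fin m × Fin m) (Fin m × Fin m) k) = Matrix.diagonal d ⊗ₖ (1 : Matrix (Fin m) (Fin m) k)}) ∪
        ({γ : GL (Fin m × Fin m) k | ∃ π : Equiv.Perm (Fin m),
          (γ : Matrix (Fin m × Fin m) (Fin m × Fin m) k) = (1 : Matrix (Fin m) (Fin m) k) ⊗ₖ π.permMatrix k} ∪
        {γ | ∃ e : Fin m → k,
          (γ : Matrix (Fin m × Fin m) (Fin m × Fin m) k) = (1 : Matrix (Fin m) (Fin m) k) ⊗ₖ Matrix.diagonal e})) ∪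
        transposeSubstSet k m) := by
  rw [permSymmetrySubst, Subgroup.closure_le]
  rintro γ ((hL | hR) | hT)
  · exact Subgroup.closure_mono (Set.subset_union_of_subset_left (Set.subset_union_left) _)
      (leftMonomialSubst_le_closure k m hL)
  · exact Subgroup.closure_mono (Set.subset_union_of_subset_left (Set.subset_union_right) _)
      (rightMonomialSubst_le_closure k m hR)
  · exact Subgroup.subset_closure (Or.inr hT)

end Group


/-! ### Assembly: the signed minor respects `𝔾_{perm_m}`; rescaling a row gives `per_m` -/

section Assembly

variable {k : Type*} [Field k] {m : ℕ}

/-- A torus element `diagonal (fun p => d p.1 * e p.2) ∈ GL(m²)` has all `d i`, `e j` nonzero.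
[folklore] -/
private theorem ne_zero_of_torus {d e : Fin m → k} (γ : GL (Fin m × Fin m) k)
    (hγ : (γ : Matrix (Fin m × Fin m) (Fin m × Fin m) k) = Matrix.diagonal fun p => d p.1 * e p.2) :
    (∀ i, d i ≠ 0) ∧ ∀ j, e j ≠ 0 := by
  have hne : ∀ p : Fin m × Fin m, d p.1 * e p.2 ≠ 0 := by
    intro p
    have hdet : (γ : Matrix (Fin m × Fin m) (Fin m × Fin m) k).det ≠ 0 :=
      (Matrix.isUnits_det_units γ).ne_zero
    rw [hγ, Matrix.det_diagonal] at hdet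
    exact (prod_ne_zero_iff.mp hdet) p (mem_univ p)
  exact ⟨fun i => left_ne_zero_of_mul (hne (i, i)), fun j => right_ne_zero_of_mul (hne (j, j))⟩


/-- **The signed minor is a `permSymmetrySubst`-equivariant affine determinantal representation of
`m! · per_m`**, with exact `GL × GL` lifts: permutation matrices for `P_π ⊗ 1`, `1 ⊗ P_π` and the
transposition (vertex relabellings fixing source and sink), diagonal vertex scalings for the torus,
products of those in general (`IsEquivariantDetRepr.of_generators`). [cite: LandsbergRessayre2017, Prop. 2.10] -/
theorem isEquivariantDetRepr_minor (hm : m ≠ 0)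
    {A : Matrix {P : Finset (Fin m) × Finset (Fin m) // P.1.card = P.2.card}
      {P : Finset (Fin m) × Finset (Fin m) // P.1.card = P.2.card} (MvPolynomial (Fin m × Fin m) k)}
    (hA : ∀ P Q, A P Q = ∑ i, ∑ j,
      if i ∉ P.1.1 ∧ j ∉ P.1.2 ∧ Q.1 = (insert i P.1.1, insert j P.1.2) then X (i, j) else 0)
    {N : ℕ} (hN : Fintype.card {P : Finset (Fin m) × Finset (Fin m) // P.1.card = P.2.card} = N + 1)
    (eqv : {P : Finset (Fin m) × Finset (Fin m) // P.1.card = P.2.card} ≃ Fin (N + 1)) :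
    IsEquivariantDetRepr (permSymmetrySubst k m)
      ((m.factorial : MvPolynomial (Fin m × Fin m) k) * perPoly (Fin m) k)
      ((-1 : MvPolynomial (Fin m × Fin m) k) ^
          ((eqv ⟨(univ, univ), rfl⟩ : ℕ) + (eqv ⟨(∅, ∅), rfl⟩ : ℕ)) •
        ((1 - A).submatrix eqv.symm eqv.symm).submatrix (eqv ⟨(univ, univ), rfl⟩).succAbove
          (eqv ⟨(∅, ∅), rfl⟩).succAbove) := by
  refine IsEquivariantDetRepr.anti ?_ (permSymmetrySubst_le_closure k m)
  refine IsEquivariantDetRepr.of_generators (isAffineDetRepr_minor hm hA hN eqv) ?_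
  have conv : ∀ {γ : GL (Fin m × Fin m) k}, (∃ P Q : GL (Fin N) k,
      Matrix.linSubstEntries γ
        ((-1 : MvPolynomial (Fin m × Fin m) k) ^
            ((eqv ⟨(univ, univ), rfl⟩ : ℕ) + (eqv ⟨(∅, ∅), rfl⟩ : ℕ)) •
          ((1 - A).submatrix eqv.symm eqv.symm).submatrix (eqv ⟨(univ, univ), rfl⟩).succAbove
            (eqv ⟨(∅, ∅), rfl⟩).succAbove) =
      (P : Matrix (Fin N) (Fin N) k).map C *
        ((-1 : MvPolynomial (Fin m × Fin m) k) ^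
            ((eqv ⟨(univ, univ), rfl⟩ : ℕ) + (eqv ⟨(∅, ∅), rfl⟩ : ℕ)) •
          ((1 - A).submatrix eqv.symm eqv.symm).submatrix (eqv ⟨(univ, univ), rfl⟩).succAbove
            (eqv ⟨(∅, ∅), rfl⟩).succAbove) *
        (Q : Matrix (Fin N) (Fin N) k).map C) →
      ∃ g h : GL (Fin N) k,
      Matrix.linSubstEntries γ
        ((-1 : MvPolynomial (Fin m × Fin m) k) ^
            ((eqv ⟨(univ, univ), rfl⟩ : ℕ) + (eqv ⟨(∅, ∅), rfl⟩ : ℕ)) •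
          ((1 - A).submatrix eqv.symm eqv.symm).submatrix (eqv ⟨(univ, univ), rfl⟩).succAbove
            (eqv ⟨(∅, ∅), rfl⟩).succAbove) =
      (g : Matrix (Fin N) (Fin N) k).map C *
        ((-1 : MvPolynomial (Fin m × Fin m) k) ^
            ((eqv ⟨(univ, univ), rfl⟩ : ℕ) + (eqv ⟨(∅, ∅), rfl⟩ : ℕ)) •
          ((1 - A).submatrix eqv.symm eqv.symm).submatrix (eqv ⟨(univ, univ), rfl⟩).succAbove
            (eqv ⟨(∅, ∅), rfl⟩).succAbove) *
        ((h⁻¹ : GL (Fin N) k) : Matrix (Fin N) (Fin N) k).map C := by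
    rintro γ ⟨P, Q, e⟩
    exact ⟨P, Q⁻¹, by rwa [inv_inv]⟩
  rintro γ (((⟨π, hπ⟩ | ⟨d, hd⟩) | (⟨π, hπ⟩ | ⟨d, hd⟩)) | hT)
  · exact conv (exists_lift_leftPerm π hA eqv γ hπ)
  · have hγ : (γ : Matrix (Fin m × Fin m) (Fin m × Fin m) k) =
        Matrix.diagonal fun p : Fin m × Fin m => d p.1 * (fun _ : Fin m => (1 : k)) p.2 := by
      rw [hd, ← Matrix.diagonal_one, Matrix.diagonal_kronecker_diagonal]
    obtain ⟨hd', he'⟩ := ne_zero_of_torus (d := d) (e := fun _ => (1 : k)) γ hγ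
    exact conv (exists_lift_torus (d := d) (e := fun _ => (1 : k)) hd' he' hA eqv γ hγ)
  · exact conv (exists_lift_rightPerm π hA eqv γ hπ)
  · have hγ : (γ : Matrix (Fin m × Fin m) (Fin m × Fin m) k) =
        Matrix.diagonal fun p : Fin m × Fin m => (fun _ : Fin m => (1 : k)) p.1 * d p.2 := by
      rw [hd, ← Matrix.diagonal_one, Matrix.diagonal_kronecker_diagonal]
    obtain ⟨hd', he'⟩ := ne_zero_of_torus (d := fun _ => (1 : k)) (e := d) γ hγ
    exact conv (exists_lift_torus (d := fun _ => (1 : k)) (e := d) hd' he' hA eqv γ hγ)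
  · exact conv (exists_lift_transpose hA eqv γ hT)


end Assembly

end LRPairs

/-! ### The theorems (Landsberg–Ressayre 2017, Prop. 2.10 and Thm. 2.1) -/

section Main

variable {k : Type*} [Field k] {m : ℕ}

/-- **Landsberg–Ressayre 2017, Prop. 2.10 (tree vocabulary): `per_m` has an affine determinantal
representation of size `C(2m, m) - 1` respecting ALL of `𝔾_{perm_m}`** — the realised symmetry group
`permSymmetrySubst k m` (left and right monomial symmetries and transposition) — with EXACT lifts in
`GL × GL` (the tree's `IsEquivariantDetRepr`), over any field in which `m! ≠ 0`. The matrix is the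
signed `(snk, src)`-minor of `1 - A` for the pairs branching program (`det = m! · per_m`,
`isEquivariantDetRepr_minor`) with one row divided by `m!` (LR rescale `Λ₀` by `(m!)^{-1/(n-m)}`
instead; either gauge keeps the lifts, `forall_exists_lift_mul_mul`). This is the UPPER-bound half
of LR Thm. 2.1 `edc(perm_m) = C(2m,m) - 1`, recorded as "not vendored" in `LandsbergRessayre.lean`.
[cite: LandsbergRessayre2017, Prop. 2.10] -/
theorem hasEquivariantDetRepr_perPoly_permSymmetrySubst (hm : m ≠ 0)
    (hfact : (m.factorial : k) ≠ 0) :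
    HasEquivariantDetRepr (permSymmetrySubst k m) (perPoly (Fin m) k) ((2 * m).choose m - 1) := by
  haveI : Nonempty (Fin m) := ⟨⟨0, Nat.pos_of_ne_zero hm⟩⟩
  -- sizes
  have hcard : Fintype.card {P : Finset (Fin m) × Finset (Fin m) // P.1.card = P.2.card} =
      (2 * m).choose m := by
    rw [LRPairs.card_balancedPairs, Fintype.card_fin]
  have h2 : 2 ∣ (2 * m).choose m := by
    have h := Nat.two_dvd_centralBinom_of_one_le (Nat.pos_of_ne_zero hm)
    exact h
  have hpos : 0 < (2 * m).choose m := Nat.choose_pos (by omega)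
  set N := (2 * m).choose m - 1 with hNdef
  have hN : Fintype.card {P : Finset (Fin m) × Finset (Fin m) // P.1.card = P.2.card} = N + 1 := by
    rw [hcard]; omega
  have hN1 : 0 < N := by
    obtain ⟨r, hr⟩ := h2
    omega
  obtain ⟨eqv⟩ : Nonempty ({P : Finset (Fin m) × Finset (Fin m) // P.1.card = P.2.card} ≃ Fin (N + 1)) :=
    ⟨Fintype.equivFinOfCardEq hN⟩
  -- the adjacency matrix
  obtain ⟨A, hA⟩ : ∃ A : Matrix {P : Finset (Fin m) × Finset (Fin m) // P.1.card = P.2.card}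
      {P : Finset (Fin m) × Finset (Fin m) // P.1.card = P.2.card} (MvPolynomial (Fin m × Fin m) k),
      ∀ P Q, A P Q = ∑ i, ∑ j,
        if i ∉ P.1.1 ∧ j ∉ P.1.2 ∧ Q.1 = (insert i P.1.1, insert j P.1.2) then X (i, j) else 0 :=
    ⟨Matrix.of fun P Q => ∑ i, ∑ j,
        if i ∉ P.1.1 ∧ j ∉ P.1.2 ∧ Q.1 = (insert i P.1.1, insert j P.1.2) then X (i, j) else 0,
      fun _ _ => rfl⟩
  have hM := LRPairs.isEquivariantDetRepr_minor hm hA hN eqv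
  rw [isEquivariantDetRepr_iff_exists_mul_mul] at hM
  -- divide row `0` by `m!`
  let i₀ : Fin N := ⟨0, hN1⟩
  let P₀ : GL (Fin N) k := Grenet.diagUnit (fun i => if i = i₀ then ((m.factorial : k))⁻¹ else 1)
    (fun i => by
      split_ifs
      · exact inv_ne_zero hfact
      · exact one_ne_zero)
  refine ⟨(P₀ : Matrix (Fin N) (Fin N) k).map C *
      ((-1 : MvPolynomial (Fin m × Fin m) k) ^
          ((eqv ⟨(univ, univ), rfl⟩ : ℕ) + (eqv ⟨(∅, ∅), rfl⟩ : ℕ)) •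
        ((1 - A).submatrix eqv.symm eqv.symm).submatrix (eqv ⟨(univ, univ), rfl⟩).succAbove
          (eqv ⟨(∅, ∅), rfl⟩).succAbove) *
      ((1 : GL (Fin N) k) : Matrix (Fin N) (Fin N) k).map C, ?_⟩
  rw [isEquivariantDetRepr_iff_exists_mul_mul]
  refine ⟨⟨totalDegree_map_C_mul_mul_map_C_le _ _ hM.1.1, ?_⟩, forall_exists_lift_mul_mul hM.2 P₀ 1⟩
  rw [det_map_C_mul_mul_map_C, hM.1.2, Grenet.val_diagUnit, Matrix.det_diagonal, Units.val_one,
    Matrix.det_one, mul_one, Finset.prod_ite_eq_of_mem' _ _ _ (mem_univ _),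
    show (m.factorial : MvPolynomial (Fin m × Fin m) k) = C (m.factorial : k) from
      (map_natCast C _).symm, ← mul_assoc, ← map_mul, inv_mul_cancel₀ hfact, map_one, one_mul]

/-- Hence `edc_{𝔾_{perm_m}}(per_m) ≤ C(2m, m) - 1` (`m ≥ 1`, `m! ≠ 0` in `k`): the upper bound of
Landsberg–Ressayre 2017, Thm. 2.1. [cite: LandsbergRessayre2017, Thm. 2.1] -/
theorem equivariantDetComplexity_permSymmetrySubst_perPoly_le (hm : m ≠ 0)
    (hfact : (m.factorial : k) ≠ 0) :
    equivariantDetComplexity (permSymmetrySubst k m) (perPoly (Fin m) k) ≤ (2 * m).choose m - 1 :=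
  equivariantDetComplexity_le (hasEquivariantDetRepr_perPoly_permSymmetrySubst hm hfact)

/-- **Landsberg–Ressayre 2017, Thm. 2.1, in full (tree's exact-lift sense): for `m ≥ 3`,
`edc(perm_m) = C(2m, m) - 1` over `ℂ`** for the realised symmetry group `permSymmetrySubst ℂ m` —
the lower bound is the tree's `lr_full_equivariant_lower_holds` / `le_equivariantDetComplexity_full`
(`LandsbergRessayreThm21Proofs.lean`), the upper bound the construction above.
[cite: LandsbergRessayre2017, Thm. 2.1] -/
theorem equivariantDetComplexity_permSymmetrySubst_perPoly_eq {m : ℕ} (hm : 3 ≤ m) :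
    equivariantDetComplexity (permSymmetrySubst ℂ m) (perPoly (Fin m) ℂ) = (2 * m).choose m - 1 := by
  have hm0 : m ≠ 0 := by omega
  have hfact : (m.factorial : ℂ) ≠ 0 := Nat.cast_ne_zero.mpr (Nat.factorial_ne_zero m)
  exact le_antisymm (equivariantDetComplexity_permSymmetrySubst_perPoly_le hm0 hfact)
    (le_equivariantDetComplexity_full hm ⟨_, hasEquivariantDetRepr_perPoly_permSymmetrySubst hm0 hfact⟩)

end Main

end Literature.Computability.AlgebraicComplexity
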